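import Summits.Parity.GeneralizedHardyLittlewood.Theorems.DilatedTableChowla.Negative.DilatedTableChowlaBlocks

/-!
# `DilatedTableChowla` (stmt-Parity-14271): the shift `c = 0`, power sums, and the test scale `x = N²⁴`

Negative lemmas for the crux `LiouvilleShiftedTables.DilatedTableChowla` (route LiouvilleShiftedTables, X1; cdisprove seat), landed verbatim from the crux work file `Cruxes/DilatedTableChowla/Disproof.lean` (§2–§3 there) so that skeletons, ideators and provers can import them.  Notation (`rows`, `cols`, `S`, `F`, `lhs`, `crux_iff_lhs`) from `DilatedTableChowlaBlocks`. [folklore]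
-/

namespace Summit.Parity.GeneralizedHardyLittlewood.Theorems.DilatedTableChowla.Negative

open Summit.Parity.GeneralizedHardyLittlewood.Theses.LiouvilleShiftedTables
open Finset

/-! ## §2 The shift `c = 0`: the fourth moment IS the trivial bound -/

/-- At `c = 0` every two-row correlation is `± #cols`: `λ(ab)λ(a'b) = λ(a)λ(a')`. -/
theorem S_zero_shift (x A : ℝ) (q v : ℕ) {a a' : ℕ} :
    S 0 x A q v a a' = ((cols x A q v).card : ℝ) * (L a * L a') := by
  unfold S
  have : ∀ b ∈ cols x A q v, L ((a : ℤ) * b + 0) * L ((a' : ℤ) * b + 0) = L a * L a' := by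
    intro b hb
    have hb : (1 : ℤ) ≤ b := by exact_mod_cast one_le_of_mem_cols hb
    rw [add_zero, add_zero, L_natCast_mul, L_natCast_mul]
    have := L_mul_self_of_pos (n := (b : ℤ)) (by linarith)
    linear_combination (L a * L a') * this
  rw [Finset.sum_congr rfl this]; simp

/-- At the shift `c = 0` the fourth moment EQUALS the trivial bound `#rows² · #cols²` (`λ(ab)λ(a'b) = λ(a)λ(a')`). -/
theorem F_zero_shift (x A : ℝ) (q u v : ℕ) :
    F 0 x A q u v = ((rows A q u).card : ℝ) ^ 2 * ((cols x A q v).card : ℝ) ^ 2 := by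
  unfold F
  have : ∀ a ∈ rows A q u, ∀ a' ∈ rows A q u,
      (S 0 x A q v a a') ^ 2 = ((cols x A q v).card : ℝ) ^ 2 := by
    intro a ha a' ha'
    have h1 : (1 : ℤ) ≤ a := by exact_mod_cast one_le_of_mem_rows ha
    have h2 : (1 : ℤ) ≤ a' := by exact_mod_cast one_le_of_mem_rows ha'
    rw [S_zero_shift, mul_pow, mul_pow, L_sq_of_pos (by linarith), L_sq_of_pos (by linarith)]
    ring
  rw [Finset.sum_congr rfl fun a ha => Finset.sum_congr rfl fun a' ha' => this a ha a' ha']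
  simp; ring



/-! ## Power sums and the scale `x = N²⁴` -/

/-- `Σ_{q=1}^{n} q³ ≥ n⁴/4`. -/
theorem sum_Icc_pow_three_ge (n : ℕ) : ((n : ℝ)) ^ 4 / 4 ≤ ∑ q ∈ Finset.Icc 1 n, ((q : ℝ)) ^ 3 := by
  induction n with
  | zero => simp
  | succ k ih =>
    rw [Finset.sum_Icc_succ_top (Nat.succ_le_succ (Nat.zero_le k))]
    push_cast
    nlinarith [sq_nonneg ((k : ℝ)), sq_nonneg ((k : ℝ) + 1), (Nat.cast_nonneg k : (0:ℝ) ≤ k)]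

/-- `Σ_{q=1}^{n} q⁴ ≥ n⁵/5`. -/
theorem sum_Icc_pow_four_ge (n : ℕ) : ((n : ℝ)) ^ 5 / 5 ≤ ∑ q ∈ Finset.Icc 1 n, ((q : ℝ)) ^ 4 := by
  induction n with
  | zero => simp
  | succ k ih =>
    rw [Finset.sum_Icc_succ_top (Nat.succ_le_succ (Nat.zero_le k))]
    push_cast
    nlinarith [sq_nonneg ((k : ℝ)), sq_nonneg ((k : ℝ) + 1), (Nat.cast_nonneg k : (0:ℝ) ≤ k),
      pow_nonneg (Nat.cast_nonneg k : (0:ℝ) ≤ k) 3, pow_nonneg (Nat.cast_nonneg k : (0:ℝ) ≤ k) 4]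

/-- `Σ_{q=1}^{n} q ≥ n²/2`. -/
theorem sum_Icc_pow_one_ge (n : ℕ) : ((n : ℝ)) ^ 2 / 2 ≤ ∑ q ∈ Finset.Icc 1 n, ((q : ℝ)) := by
  induction n with
  | zero => simp
  | succ k ih =>
    rw [Finset.sum_Icc_succ_top (Nat.succ_le_succ (Nat.zero_le k))]
    push_cast
    nlinarith

/-! ### The scale `x = N²⁴` (`δ = 1/12`: `x^δ = N²`, `x^{δ/2} = N`, `x^{1/3+δ} = N¹⁰`) -/

/-- `(N²⁴)^e = N^{24e}` (real powers). -/
theorem rpow_pow24 (N : ℕ) (e : ℝ) : (((N : ℝ) ^ 24) : ℝ) ^ e = (N : ℝ) ^ (24 * e) := by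
  rw [show ((N : ℝ) ^ 24 : ℝ) = (N : ℝ) ^ ((24 : ℕ) : ℝ) by rw [Real.rpow_natCast],
    ← Real.rpow_mul (Nat.cast_nonneg N)]
  norm_num

/-- `(N²⁴)^e = N^k` when `24e = k`. -/
theorem pow24_rpow_eq_pow (N : ℕ) {e : ℝ} {k : ℕ} (h : 24 * e = k) :
    (((N : ℝ) ^ 24) : ℝ) ^ e = (N : ℝ) ^ k := by
  rw [rpow_pow24, h, Real.rpow_natCast]

/-- `⌊N^k⌋₊ = N^k`. -/
theorem floor_natCast_pow (N k : ℕ) : ⌊((N : ℝ)) ^ k⌋₊ = N ^ k := by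
  rw [← Nat.cast_pow, Nat.floor_natCast]

/-- `⌊2 N^k⌋₊ = 2 N^k`. -/
theorem floor_two_mul_natCast_pow (N k : ℕ) : ⌊2 * ((N : ℝ)) ^ k⌋₊ = 2 * N ^ k := by
  rw [show (2 : ℝ) * (N : ℝ) ^ k = ((2 * N ^ k : ℕ) : ℝ) by push_cast; ring, Nat.floor_natCast]

/-- `N²⁴ / N^j = N^{24−j}` for `j ≤ 24`, `N ≠ 0`. -/
theorem pow24_div_pow (N : ℕ) (hN : N ≠ 0) {j : ℕ} (hj : j ≤ 24) :
    ((N : ℝ)) ^ 24 / (N : ℝ) ^ j = (N : ℝ) ^ (24 - j) := by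
  have hN' : (N : ℝ) ≠ 0 := by exact_mod_cast hN
  rw [div_eq_iff (pow_ne_zero _ hN'), ← pow_add, Nat.sub_add_cancel hj]

/-- `log (N²⁴) = 24 log N`. -/
theorem log_pow24 (N : ℕ) : Real.log (((N : ℝ)) ^ 24) = 24 * Real.log N := by
  rw [Real.log_pow]; norm_num

/-- `16 < log (N²⁴)` for `N ≥ 2`. -/
theorem sixteen_lt_log_pow24 {N : ℕ} (hN : 2 ≤ N) : 16 < Real.log (((N : ℝ)) ^ 24) := by
  rw [log_pow24]
  have h2 : Real.log 2 ≤ Real.log N := Real.log_le_log two_pos (by exact_mod_cast hN)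
  have := Real.log_two_gt_d9
  linarith

/-- `1 ≤ N²⁴` for `N ≥ 1`. -/
theorem one_le_pow24 {N : ℕ} (hN : 1 ≤ N) : (1 : ℝ) ≤ ((N : ℝ)) ^ 24 :=
  one_le_pow₀ (by exact_mod_cast hN)

/-- `N ≤ N²⁴` for `N ≥ 1`. -/
theorem self_le_pow24 {N : ℕ} (hN : 1 ≤ N) : (N : ℝ) ≤ ((N : ℝ)) ^ 24 :=
  le_self_pow₀ (by exact_mod_cast hN) (by norm_num)

/-- With `C = 1` the right-hand side at `x = N²⁴` is `< N⁴⁸/16`. -/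
theorem rhs_pow24_lt {N : ℕ} (hN : 2 ≤ N) :
    (((N : ℝ)) ^ 24) ^ 2 / Real.log (((N : ℝ)) ^ 24) ^ (1 : ℝ) < ((N : ℝ)) ^ 48 / 16 := by
  rw [Real.rpow_one, ← pow_mul, log_pow24]
  norm_num
  have hlog : (16 : ℝ) < 24 * Real.log N := by
    have := sixteen_lt_log_pow24 hN; rwa [log_pow24] at this
  have hpos : (0 : ℝ) < (N : ℝ) ^ 48 := by
    have : (0 : ℝ) < N := by exact_mod_cast (by omega : 0 < N)
    positivity
  exact div_lt_div_of_pos_left hpos (by norm_num) hlog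

/-- Choosing the scale: a natural number `N ≥ m` with `N ≥ x₀` (hence `N²⁴ ≥ x₀`). -/
theorem exists_scale (x₀ : ℝ) (m : ℕ) (hm : 1 ≤ m) :
    ∃ N : ℕ, m ≤ N ∧ x₀ ≤ (N : ℝ) ∧ x₀ ≤ ((N : ℝ)) ^ 24 := by
  obtain ⟨N, hN⟩ := exists_nat_ge (max x₀ m)
  have h1 : (m : ℝ) ≤ N := le_trans (le_max_right _ _) hN
  have h2 : x₀ ≤ N := le_trans (le_max_left _ _) hN
  have hmN : m ≤ N := by exact_mod_cast h1
  exact ⟨N, hmN, h2, h2.trans (self_le_pow24 (hm.trans hmN))⟩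

end Summit.Parity.GeneralizedHardyLittlewood.Theorems.DilatedTableChowla.Negative
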